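import Mathlib
import Literature.AlgebraicGeometry.Resolution.FundamentalLocus
import Literature.AlgebraicGeometry.Resolution.Lipman1969RationalSurfaceSingularities
import Literature.AlgebraicGeometry.Resolution.RationalSurfaceSingularitiesBasic
import Literature.AlgebraicGeometry.Motives.GoodReductionSpecialFibreProofs
import Literature.AlgebraicGeometry.Morphisms.CechH1
import Literature.AlgebraicGeometry.Morphisms.CechH1Leray
import Literature.AlgebraicGeometry.Morphisms.CechH1AffineProofs
import Literature.AlgebraicGeometry.Morphisms.CechH1BasicOpenTorsion
import Literature.AlgebraicGeometry.Morphisms.DevissageHeart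
import Literature.AlgebraicGeometry.Morphisms.CechH2FibreDimOne
import Summits.ResolutionOfSingularities.ResolutionOfSingularities.Theorems.HomologicalConductorSurfaceTerminationGenusDefs
import Summits.ResolutionOfSingularities.ResolutionOfSingularities.Theorems.HomologicalConductorSurfaceTerminationRationalPropagation
import Summits.ResolutionOfSingularities.ResolutionOfSingularities.Theorems.HomologicalConductorNoZenoResolutionThrough
import Summits.ResolutionOfSingularities.ResolutionOfSingularities.Theorems.HomologicalConductorNoZenoThreadLocalisation
import Summits.ResolutionOfSingularities.ResolutionOfSingularities.Theorems.HomologicalConductorPersistenceSurfaceTowerDim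
import HarnessLib

/-!
# Route `HomologicalConductor`, support `SurfaceTermination` (stmt-ResolutionOfSingularities-16488), LINE
# genus-descent: `stub_pgFinite` — every stage of the canonical `ca`-tower has FINITE GEOMETRIC GENUS

`[OURS · L W4.4]` Cell res-hironaka, crux chain W4.4, kill test K4.4-s; object U3 of the planner's
UNCLAIMED-STUB LIST v2 / CHAIN v13 §2 (prover res-L0-w44-stub-3).  Nothing here is a statement of the
manuscript under review (Hironaka 2017); AI-written, weaker than expert review.

The registered kill-test skeleton (LINE genus-descent r3/r4 on stmt-16488; res-L0-w44-strat-1, registered by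
res-L0-w44-plan-1) has the stub `Sig.pgFinite`: modulo the crux's six named facts, along a prime divisor every
stage `T_(m+1) = tower O A (m+1)` satisfies `∃ g, HasGeometricGenusLE ↥T_(m+1) g` (vocabulary
`…SurfaceTerminationGenusDefs`: SOME resolution has `length Ȟ¹(𝒰, 𝒪_X) ≤ g` for EVERY finite affine cover).
This file proves it, BY NAME AND SIGNATURE (`stub_pgFinite`), in fact for every valuation ring `O` and using
Cossart–Jannsen–Saito only:

* `isAffineOpen_basicOpen_of_isResolution` — for a resolution `ρ : X → Spec T` of a two-dimensional normal
  Noetherian local domain and `y ∈ 𝔪`, the open `X_y = ρ⁻¹ D(y)` is AFFINE: `D(y)` consists of primes of height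
  `≤ 1`, normal points of codimension `≤ 1` lie in the iso locus of a proper birational morphism
  (`FundamentalLocus.mem_isoLocus_of_ringKrullDim_le_one`), so `ρ⁻¹ D(y) ≅ D(y) = Spec T_y`.
* `length_ne_top_of_locallyNilpotent` — a finitely generated module over a Noetherian local ring on which `𝔪`
  acts locally nilpotently has finite length (it is a module over the Artinian `R/𝔪^N`).
* `length_cechH1_le_of_isAffineOpen` — `length Ȟ¹(𝒰', 𝒪_X) ≤ length Ȟ¹(𝒰, 𝒪_X)` for any finite cover `𝒰'` and
  any finite AFFINE cover `𝒰` (common refinement; refinement injective on `Ȟ¹`, Leray surjectivity from the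
  vanishing of `Ȟ¹` on families covering an affine open — tree `cechRefineH1_injective/_surjective`,
  `cechH1_affine_vanishing_holds`).
* `length_cechH1_ne_top_of_isResolution` — `Ȟ¹(𝒰, 𝒪_X)` of a resolution of a two-dimensional normal Noetherian
  local domain has FINITE LENGTH: finitely generated by the tree's THEOREM `cechH1_finite_holds` (coherence of
  `R¹ρ_*`, Görtz–Wedhorn II 23.17 / Stacks 02O5, proved in `Morphisms/DevissageHeart`), and `𝔪`-power torsion by
  `CechH1.exists_pow_smul_eq_zero_of_isAffineOpen_basicOpen` (Part A, `Morphisms/CechH1BasicOpenTorsion`) since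
  each `X_y` is affine.
* `exists_isResolution_Spec_of_cjsGeneral` — a resolution of `Spec T` exists for `T` a normal Noetherian domain
  essentially of finite type over a field of dimension `≤ 2` (stub-6's `exists_isResolution_through_of_cjsGeneral`
  through the generic point).
* `exists_hasGeometricGenusLE_tower_succ` — **`∃ g, HasGeometricGenusLE ↥(tower O A (n+1)) g` for every datum of
  transcendence degree `2` and every `O`**, modulo CJS (regular stage: genus `0`; singular stage:
  `RationalDescent.stage_package_of_trdeg` + the above).
* `stub_pgFinite` — the registered text (six-fact binder written out; the three prime-divisor hypotheses and five
  of the six facts are inert).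

References: U. Görtz, T. Wedhorn, *Algebraic Geometry II* (2023), Lemma 22.1, Cor. 21.81/21.82, Thm. 23.17 /
Cor. 23.18 [`GortzWedhorn2023`]; O. Piltant, RACSAM 107 (2013), proof of Prop. 5.1 Step 3 (fundamental locus)
[`Piltant2013`]; V. Cossart, U. Jannsen, S. Saito, LNM 2270 (2020), Thm 1.2 [`CossartJannsenSaito2020`];
J. Lipman, Publ. IHÉS 36 (1969), Def. (1.1) [`Lipman1969`].
-/

-- single-problem summit: the doubled namespace component `ResolutionOfSingularities` is forced
set_option linter.dupNamespace false

noncomputable section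

open CategoryTheory AlgebraicGeometry TopologicalSpace IsLocalRing
open Literature.AlgebraicGeometry.Resolution Literature.AlgebraicGeometry.Morphisms
open Summit.ResolutionOfSingularities.ResolutionOfSingularities.Theorems
open Summit.ResolutionOfSingularities.ResolutionOfSingularities.Theorems.NoZeno.Birth

namespace Summit.ResolutionOfSingularities.ResolutionOfSingularities.Theorems.SurfaceTermination.GenusDescent

/-- **The preimage of a principal open `D(y)`, `y ∈ 𝔪`, under a resolution of a two-dimensional normal
Noetherian local domain is AFFINE.**  The points of `D(y) ⊆ Spec T` are primes `𝔭 ≠ 𝔪`, of height `≤ 1`,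
where `T_𝔭` is a normal local ring of dimension `≤ 1`; a proper birational morphism from an integral scheme
is an isomorphism over such points (the fundamental locus has codimension `≥ 2` at normal points:
`mem_isoLocus_of_ringKrullDim_le_one`), so `ρ⁻¹(D(y)) ≅ D(y) = Spec T_y`.
[cite: Piltant2013, proof of Prop. 5.1, Step 3] -/
theorem isAffineOpen_basicOpen_of_isResolution {T : Type} [CommRing T] [IsDomain T] [IsNoetherianRing T]
    [IsLocalRing T] [IsIntegrallyClosed T] (hdim : ringKrullDim T = 2)
    {X : Scheme.{0}} (ρ : X ⟶ Spec (.of T)) (hρ : IsResolution ρ)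
    (y : T) (hy : y ∈ maximalIdeal T) :
    IsAffineOpen (X.basicOpen (algebraMapΓ ρ y)) := by
  haveI : IsIntegral X := hρ.isIntegral_source
  haveI : IsProper ρ := hρ.isProper
  haveI : IsDomain (CommRingCat.of T) := ‹IsDomain T›
  haveI : IsNoetherianRing (CommRingCat.of T) := ‹IsNoetherianRing T›
  -- the principal open `D(y)` of `Spec T`
  set r : Γ(Spec (.of T), ⊤) := (Scheme.ΓSpecIso (.of T)).inv y with hr
  let D : (Spec (.of T)).Opens := (Spec (.of T)).basicOpen r
  have hDeq : D = PrimeSpectrum.basicOpen (R := T) y := basicOpen_eq_of_affine (R := .of T) y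
  have hDaff : IsAffineOpen D := (isAffineOpen_top (Spec (.of T))).basicOpen r
  have hpre : ρ ⁻¹ᵁ D = X.basicOpen (algebraMapΓ ρ y) := Scheme.preimage_basicOpen_top ρ r
  -- every point of `D(y)` has a local ring of dimension `≤ 1`
  have hD : D ≤ ρ.isoLocus := by
    intro 𝔭 h𝔭
    have hy𝔭 : y ∉ 𝔭.asIdeal := by
      have : 𝔭 ∈ PrimeSpectrum.basicOpen (R := T) y := by rw [← hDeq]; exact h𝔭
      exact this
    have hne : 𝔭.asIdeal ≠ maximalIdeal T := fun h => hy𝔭 (h ▸ hy)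
    have hlt : 𝔭.asIdeal.height < (maximalIdeal T).height :=
      Ideal.height_strict_mono_of_isPrime_of_isPrime
        (lt_of_le_of_ne (IsLocalRing.le_maximalIdeal Ideal.IsPrime.ne_top') hne)
    have hm : (maximalIdeal T).height = 2 := by
      have h := IsLocalRing.maximalIdeal_height_eq_ringKrullDim (R := T)
      rw [hdim] at h
      rwa [← WithBot.coe_inj]
    have hle : 𝔭.asIdeal.height ≤ 1 := by
      rw [hm] at hlt
      have : 𝔭.asIdeal.height < ⊤ := lt_of_lt_of_le hlt le_top
      obtain ⟨n, hn⟩ := ENat.ne_top_iff_exists.mp this.ne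
      rw [← hn] at hlt ⊢
      have : n < 2 := by exact_mod_cast hlt
      exact_mod_cast Nat.lt_succ_iff.mp this
    have hstalk : ringKrullDim ((Spec (.of T)).presheaf.stalk 𝔭) ≤ 1 := by
      letI : Algebra T ((Spec (.of T)).presheaf.stalk 𝔭) :=
        inferInstanceAs (Algebra T ((Spec.structureSheaf T).presheaf.stalk 𝔭))
      haveI : IsLocalization.AtPrime ((Spec (.of T)).presheaf.stalk 𝔭) 𝔭.asIdeal :=
        StructureSheaf.IsLocalization.to_stalk T 𝔭
      rw [IsLocalization.AtPrime.ringKrullDim_eq_height 𝔭.asIdeal ((Spec (.of T)).presheaf.stalk 𝔭)]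
      exact_mod_cast hle
    exact mem_isoLocus_of_ringKrullDim_le_one ρ hρ.isBirational ⊤
      (fun q _ => Literature.AlgebraicGeometry.Motives.isIntegrallyClosed_stalk_Spec (.of T) q)
      (Opens.mem_top 𝔭) hstalk
  -- `ρ` is an isomorphism over `D(y)`
  haveI : IsIso (ρ ∣_ ρ.isoLocus) := isIso_morphismRestrict_isoLocus ρ
  have himg : ρ.isoLocus.ι ''ᵁ (ρ.isoLocus.ι ⁻¹ᵁ D) = D := by
    rw [Scheme.Hom.image_preimage_eq_opensRange_inf, Scheme.Opens.opensRange_ι]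
    exact inf_eq_right.mpr hD
  have hiso : IsIso (ρ ∣_ D) := by
    have h1 : IsIso ((ρ ∣_ ρ.isoLocus) ∣_ (ρ.isoLocus.ι ⁻¹ᵁ D)) := inferInstance
    have h2 : IsIso (ρ ∣_ (ρ.isoLocus.ι ''ᵁ (ρ.isoLocus.ι ⁻¹ᵁ D))) :=
      ((MorphismProperty.isomorphisms Scheme).arrow_mk_iso_iff
        (morphismRestrictRestrict ρ ρ.isoLocus (ρ.isoLocus.ι ⁻¹ᵁ D))).mp h1
    exact ((MorphismProperty.isomorphisms Scheme).arrow_mk_iso_iff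
      (morphismRestrictEq ρ himg)).mp h2
  -- hence `ρ⁻¹ D(y)` is affine
  haveI : IsAffine D := hDaff
  have : IsAffineOpen (ρ ⁻¹ᵁ D) := IsAffine.of_isIso (ρ ∣_ D)
  rwa [hpre] at this

/-! ## Algebra: a finitely generated module on which the maximal ideal acts locally nilpotently has finite length -/

/-- Over a Noetherian local ring `(R, 𝔪)`, a finitely generated module `M` on which every `y ∈ 𝔪` acts
locally nilpotently (`∀ m, ∃ n, yⁿ m = 0`) has FINITE LENGTH: `𝔪` is finitely generated and `M` has finitely
many generators, so `𝔪^N M = 0` for some `N`, and `M` is a finitely generated module over the Artinian local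
ring `R/𝔪^N`. [folklore] -/
theorem length_ne_top_of_locallyNilpotent {R : Type*} [CommRing R] [IsNoetherianRing R] [IsLocalRing R]
    {M : Type*} [AddCommGroup M] [Module R M] [Module.Finite R M]
    (h : ∀ y ∈ maximalIdeal R, ∀ m : M, ∃ n : ℕ, y ^ n • m = 0) : Module.length R M ≠ ⊤ := by
  classical
  -- `𝔪 ≤ √(Ann M)`
  have hrad : maximalIdeal R ≤ (Module.annihilator R M).radical := by
    intro y hy
    obtain ⟨S, hS⟩ := Module.Finite.fg_top (R := R) (M := M)
    choose n hn using fun m : M => h y hy m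
    refine ⟨S.sup n, Module.mem_annihilator.mpr fun m => ?_⟩
    have hm : m ∈ Submodule.span R (S : Set M) := by rw [hS]; exact Submodule.mem_top
    induction hm using Submodule.span_induction with
    | mem x hx =>
      have hle : n x ≤ S.sup n := Finset.le_sup hx
      rw [← Nat.sub_add_cancel hle, pow_add, mul_smul, hn x, smul_zero]
    | zero => rw [smul_zero]
    | add x y _ _ hx hy => rw [smul_add, hx, hy, add_zero]
    | smul a x _ hx => rw [smul_comm, hx, smul_zero]
  obtain ⟨N, hN⟩ := Ideal.exists_pow_le_of_le_radical_of_fg hrad (IsNoetherian.noetherian _)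
  -- `M` is a module over the Artinian local ring `R ⧸ 𝔪^N`
  set J : Ideal R := maximalIdeal R ^ N with hJ
  by_cases hJtop : J = ⊤
  · -- then `1 ∈ Ann M`, `M = 0`
    have h1 : (1 : R) ∈ Module.annihilator R M := hN (hJtop ▸ Submodule.mem_top)
    haveI : Subsingleton M := ⟨fun a b => by
      have ha := Module.mem_annihilator.mp h1 a
      have hb := Module.mem_annihilator.mp h1 b
      rw [one_smul] at ha hb
      rw [ha, hb]⟩
    rw [Module.length_eq_zero]
    exact ENat.zero_ne_top
  have htors : Module.IsTorsionBySet R M (J : Set R) :=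
    (Module.isTorsionBySet_iff_subset_annihilator R M).mpr hN
  letI : Module (R ⧸ J) M := htors.module
  haveI : IsScalarTower R (R ⧸ J) M := htors.isScalarTower
  haveI : Nontrivial (R ⧸ J) := Ideal.Quotient.nontrivial_iff.mpr hJtop
  haveI : IsLocalRing (R ⧸ J) :=
    IsLocalRing.of_surjective' (Ideal.Quotient.mk J) Ideal.Quotient.mk_surjective
  haveI : IsArtinianRing (R ⧸ J) := by
    rw [isArtinianRing_iff_isNilpotent_maximalIdeal]
    refine ⟨N, ?_⟩
    rw [← IsLocalRing.map_maximalIdeal_of_surjective (Ideal.Quotient.mk J) Ideal.Quotient.mk_surjective,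
      ← Ideal.map_pow, Ideal.zero_eq_bot, hJ, Ideal.map_quotient_self]
  haveI : Module.Finite (R ⧸ J) M := Module.Finite.of_restrictScalars_finite R (R ⧸ J) M
  have hsurj : Function.Surjective (algebraMap R (R ⧸ J)) := by
    rw [Ideal.Quotient.algebraMap_eq]; exact Ideal.Quotient.mk_surjective
  rw [Module.length_eq_of_surjective (S := R) (R := R ⧸ J) hsurj]
  exact Module.length_ne_top

/-! ## Čech: comparing finite covers -/

/-- **The length of `Ȟ¹(𝒰', 𝒪_X)` for ANY finite open cover `𝒰'` is at most that of `Ȟ¹(𝒰, 𝒪_X)` for a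
finite AFFINE open cover `𝒰`** (both computed in the tree's `CechH1`): through the common refinement
`𝒱 = (U_i ∩ U'_{i'})`, `Ȟ¹(𝒰') ↪ Ȟ¹(𝒱)` (refinement is injective on `Ȟ¹`, Görtz–Wedhorn II Cor. 21.81) and
`Ȟ¹(𝒰) ↠ Ȟ¹(𝒱)` (Leray in degree one: `Ȟ¹` of `𝒪` vanishes on every family covering the affine `U_i`,
Lemma 22.1 / Cor. 21.82).  In particular all finite affine open covers give `Ȟ¹` of the same length.
[cite: GortzWedhorn2023, Cor. 21.81 and Cor. 21.82 (p. 265)] -/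
theorem length_cechH1_le_of_isAffineOpen {A : Type} [CommRing A] {X : Scheme.{0}}
    (f : X ⟶ Spec (.of A)) {ι ι' : Type} [Finite ι] [Finite ι'] (U : ι → X.Opens) (U' : ι' → X.Opens)
    (hU : ∀ i, IsAffineOpen (U i)) (hcov : ⨆ i, U i = ⊤) (hcov' : ⨆ i', U' i' = ⊤) :
    Module.length A (CechH1 f U') ≤ Module.length A (CechH1 f U) := by
  -- the common refinement
  let V : ι × ι' → X.Opens := fun q => U q.1 ⊓ U' q.2
  have hVU : ∀ q, V q ≤ U (Prod.fst q) := fun q => inf_le_left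
  have hVU' : ∀ q, V q ≤ U' (Prod.snd q) := fun q => inf_le_right
  have hVcov : ⨆ q, V q = ⊤ := by
    rw [iSup_prod]
    change ⨆ i, ⨆ i', U i ⊓ U' i' = ⊤
    simp_rw [← inf_iSup_eq, hcov', inf_top_eq, hcov]
  have hinj : Function.Injective (cechRefineH1 f U' V Prod.snd hVU') :=
    cechRefineH1_injective f U' V Prod.snd hVU' fun i' => by rw [hVcov]; exact le_top
  have hsurj : Function.Surjective (cechRefineH1 f U V Prod.fst hVU) := by
    refine cechRefineH1_surjective f U V Prod.fst hVU (fun i => by rw [hVcov]; exact le_top)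
      fun i => cechH1_affine_vanishing_holds f (hU i) (fun q => U i ⊓ V q) ?_
    rw [← inf_iSup_eq, hVcov, inf_top_eq]
  exact (Module.length_le_of_injective _ hinj).trans (Module.length_le_of_surjective _ hsurj)

/-! ## `Ȟ¹(𝒰, 𝒪_X)` of a resolution of a normal surface germ has finite length -/

/-- **`Ȟ¹(𝒰, 𝒪_X)` has FINITE LENGTH for a resolution `ρ : X → Spec T` of a two-dimensional normal Noetherian
local domain** and any finite affine open cover `𝒰` of `X`: it is finitely generated (coherence of `R¹ρ_*`,
the tree's `cechH1_finite_holds` — Görtz–Wedhorn II Thm. 23.17 / Stacks 02O5, PROVED in the tree) and every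
`y ∈ 𝔪` acts nilpotently on it (`X_y ≅ D(y)` is affine, `isAffineOpen_basicOpen_of_isResolution`, and `Ȟ¹` is
`y`-power torsion when `X_y` is affine, `CechH1.exists_pow_smul_eq_zero_of_isAffineOpen_basicOpen`).
[cite: GortzWedhorn2023, Cor. 23.18] -/
theorem length_cechH1_ne_top_of_isResolution {T : Type} [CommRing T] [IsDomain T] [IsNoetherianRing T]
    [IsLocalRing T] [IsIntegrallyClosed T] (hdim : ringKrullDim T = 2)
    {X : Scheme.{0}} (ρ : X ⟶ Spec (.of T)) (hρ : IsResolution ρ)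
    {ι : Type} [Finite ι] (U : ι → X.Opens) (hU : ∀ i, IsAffineOpen (U i)) (hcov : ⨆ i, U i = ⊤) :
    Module.length T (CechH1 ρ U) ≠ ⊤ := by
  haveI : IsProper ρ := hρ.isProper
  haveI : IsNoetherianRing (CommRingCat.of T) := ‹IsNoetherianRing T›
  haveI : Module.Finite T (CechH1 ρ U) := cechH1_finite_holds ρ U hU hcov
  haveI : X.IsSeparated := ⟨by rw [← Limits.terminal.comp_from ρ]; infer_instance⟩
  exact length_ne_top_of_locallyNilpotent fun y hy ξ =>
    CechH1.exists_pow_smul_eq_zero_of_isAffineOpen_basicOpen ρ U hU (fun i j => (hU i).inf (hU j))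
      hcov y (isAffineOpen_basicOpen_of_isResolution hdim ρ hρ y hy) ξ

/-! ## The geometric genus of every stage of the tower is finite -/

/-- **A resolution of `Spec T` exists for every Noetherian domain `T` essentially of finite type over a field,
of dimension `≤ 2`** (modulo Cossart–Jannsen–Saito: the tree's `exists_isResolution_through_of_cjsGeneral`,
res-L0-w44-stub-6, taken through the generic point — `𝔮 = ⊥`, whose local ring `T_⊥` is regular).
[cite: CossartJannsenSaito2020, Thm. 1.2] -/
theorem exists_isResolution_Spec_of_cjsGeneral (hCJS : CossartJannsenSaito2020General.{0})
    (k : Type) [Field k] (T : Type) [CommRing T] [IsDomain T] [IsNoetherianRing T] [IsIntegrallyClosed T]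
    [Algebra k T] (hET : Algebra.EssFiniteType k T) (hdim : ringKrullDim T ≤ 2) :
    ∃ (X : Scheme.{0}) (ρ : X ⟶ Spec (.of T)), IsResolution ρ := by
  have hTexc : IsExcellentRing T := (isExcellentRing_of_field k).of_essFiniteType hET
  have hreg : IsRegularLocalRing (Localization.AtPrime (⊥ : Ideal T)) :=
    NoZeno.SandwichCluster.Thread.isRegularLocalRing_localization_of_height_le_one (⊥ : Ideal T)
      (by rw [Ideal.height_bot]; exact bot_le)
  obtain ⟨X, ρ, hρ, -⟩ := NoZeno.SandwichCluster.exists_isResolution_through_of_cjsGeneral hCJS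
    (R := T) (B := T) hTexc hdim
    (fun _ _ h => h) (1 : T) one_ne_zero (fun b => ⟨0, b, by simp⟩) (⊥ : Ideal T)
    (S := Localization.AtPrime (⊥ : Ideal T)) hreg
  exact ⟨X, ρ, hρ⟩

/-- **Every stage `T_(n+1)` of the canonical `ca`-tower of a surface datum has finite geometric genus**
(`∃ g, p_g(T_(n+1)) ≤ g`, in the line's vocabulary `HasGeometricGenusLE`), for EVERY valuation ring `O`, modulo
Cossart–Jannsen–Saito only: a regular stage has genus `0` (the identity resolution); a singular stage is a
two-dimensional normal local domain essentially of finite type (`RationalDescent.stage_package_of_trdeg`), a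
resolution exists (CJS), and the length of `Ȟ¹(𝒰, 𝒪_X)` is finite for one finite affine cover
(`length_cechH1_ne_top_of_isResolution`) and bounded by it for all (`length_cechH1_le_of_isAffineOpen`).
[cite: CossartJannsenSaito2020, Thm. 1.2] [cite: GortzWedhorn2023, Cor. 23.18] -/
theorem exists_hasGeometricGenusLE_tower_succ (hCJS : CossartJannsenSaito2020General.{0})
    (p : ℕ) (_hp : p.Prime) (k K : Type) [Field k] [CharP k p] [Field K] [Algebra k K]
    (O : ValuationSubring K) (A : Subalgebra k K) (hk : ∀ c : k, algebraMap k K c ∈ O) (hA : A.FG)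
    (hfr : IsFractionRing ↥A K) (hAO : A.toSubring ≤ O.toSubring) (htr : Algebra.trdeg k K = 2) (n : ℕ) :
    ∃ g : ℕ, HasGeometricGenusLE ↥(tower O A (n + 1)) g := by
  classical
  by_cases hreg : IsRegularLocalRing ↥(tower O A (n + 1))
  · haveI := hreg
    exact ⟨0, (hasGeometricGenusLE_zero_iff _).mpr
      (NoZeno.SandwichCluster.hasRationalSingularity_of_isRegularLocalRing _)⟩
  -- a singular stage: two-dimensional normal Noetherian local domain, essentially of finite type over `k`
  obtain ⟨hnoeth, hnorm, -, hloc, hdim2, hET⟩ :=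
    SurfaceTermination.RationalDescent.stage_package_of_trdeg O A hk hA hfr hAO htr n hreg
  haveI := hnoeth; haveI := hnorm; haveI := hloc
  obtain ⟨X, ρ, hρ⟩ := exists_isResolution_Spec_of_cjsGeneral hCJS k ↥(tower O A (n + 1)) hET hdim2.le
  -- a finite affine open cover of the (quasi-compact) resolution
  haveI : IsProper ρ := hρ.isProper
  haveI : CompactSpace X := QuasiCompact.compactSpace_of_compactSpace ρ
  obtain ⟨S, hS, hcov⟩ := (isCompact_iff_finite_and_eq_biUnion_affineOpens (U := (⊤ : X.Opens))).mp
    (CompactSpace.isCompact_univ (X := X))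
  haveI : Finite S := hS.to_subtype
  let U₀ : S → X.Opens := fun i => (i.1 : X.Opens)
  have hU₀aff : ∀ i, IsAffineOpen (U₀ i) := fun i => i.1.2
  have hU₀cov : ⨆ i, U₀ i = ⊤ := by
    change ⨆ i : S, ((i.1 : X.affineOpens) : X.Opens) = ⊤
    rw [iSup_subtype'', ← hcov]
  -- its `Ȟ¹` has finite length `g`, which bounds `Ȟ¹` of every finite affine cover
  obtain ⟨g, hg⟩ := ENat.ne_top_iff_exists.mp
    (length_cechH1_ne_top_of_isResolution hdim2 ρ hρ U₀ hU₀aff hU₀cov)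
  refine ⟨g, X, ρ, hρ, fun ι _ U _hU hUcov => ?_⟩
  rw [hg]
  exact length_cechH1_le_of_isAffineOpen ρ U₀ U hU₀aff hU₀cov hUcov

/-- **Stub `stub_pgFinite` of the kill-test skeleton (LINE genus-descent r3/r4 on stmt-16488, res-L0-w44-strat-1 /
res-L0-w44-plan-1) BY NAME AND SIGNATURE** — `Sig.pgFinite` verbatim with its leading six-fact binder written
out: modulo the crux's named-fact bundle, along a prime divisor every stage `T_(m+1)` has `p_g < ∞`.  Only
Cossart–Jannsen–Saito is used (resolution existence); the other five facts and the three prime-divisor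
hypotheses are inert; `cechH1_finite` enters as the tree's THEOREM `cechH1_finite_holds`.
[cite: CossartJannsenSaito2020, Thm. 1.2] [cite: GortzWedhorn2023, Cor. 23.18] -/
theorem stub_pgFinite
    (hF : (Literature.AlgebraicGeometry.Resolution.CossartJannsenSaito2020General.{0} ∧
      Literature.AlgebraicGeometry.Resolution.Lipman1969_1_2.{0} ∧
      Literature.AlgebraicGeometry.Resolution.Lipman1969_4_1.{0} ∧
      Literature.AlgebraicGeometry.Resolution.Lipman1969_12_1_i.{0} ∧
      Literature.AlgebraicGeometry.Resolution.Lipman1969_12_1_ii.{0} ∧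
      Literature.AlgebraicGeometry.Morphisms.GortzWedhorn2023_24_44_H2.{0})) :
    ∀ p : ℕ, p.Prime → ∀ (k K : Type) [Field k] [CharP k p] [Field K] [Algebra k K]
    (O : ValuationSubring K) (A : Subalgebra k K) (hk : ∀ c : k, algebraMap k K c ∈ O), A.FG →
    IsFractionRing ↥A K → A.toSubring ≤ O.toSubring → ringKrullDim ↥A = 2 →
    O ≠ ⊤ → IsDiscreteValuationRing ↥O → residueTrdeg k O hk + 1 = Algebra.trdeg k K →
    ∀ m : ℕ, ∃ g : ℕ, HasGeometricGenusLE ↥(tower O A (m + 1)) g := by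
  intro p hp k K _ _ _ _ O A hk hA hfr hAO hdimA _ _ _ m
  haveI := hfr
  exact exists_hasGeometricGenusLE_tower_succ hF.1 p hp k K O A hk hA hfr hAO
    (HomologicalConductor.PersistenceSurfaceTowerDim.trdeg_eq_of_ringKrullDim_eq A hA (d := 2)
      (by exact_mod_cast hdimA)) m

end Summit.ResolutionOfSingularities.ResolutionOfSingularities.Theorems.SurfaceTermination.GenusDescent

end
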